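import Literature.AlgebraicGeometry.Frobenioids.QuasiTemperoidPushforward

/-!
# Frobenioids II, Example 1.3 (ii): the push-forward `φ_* : B^temp(Π₁)⁰ → B^temp(Π₂)⁰` is FUNCTORIAL IN COMMUTING SQUARES
# of (iso, surjection) — `(ι⁻¹)^* ∘ φ_* ≅ φ′_* ∘ (θ⁻¹)^*` for `ι ∘ φ = φ′ ∘ θ` (proof-only)

Mochizuki, *The geometry of Frobenioids II*, Kyushu J. Math. **62** (2008) 401–460, §1, Example 1.3 (ii), p. 11
[cite: MochizukiFrdII2008, Ex 1.3 (ii) p.11]: "`φ` induces a natural functor `φ_* : B^temp(Π₁)⁰ → B^temp(Π₂)⁰` …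
obtained by mapping a `Π₁`-set `E` to the `φ(Π₁)`-set `E' := E/Ker(φ)`"; Theorem 2.4 (i) p. 19: an equivalence `Ψ`
"induces … an outer isomorphism `Π₁ ⥲ Π₂` … that lies over an outer isomorphism `G₁ ⥲ G₂`" — the square
`θ : Π ⥲ Π′`, `ι : G ⥲ G′`, `ι ∘ φ = φ′ ∘ θ` along which the Definition 2.2 data are transported.
Mochizuki, *Semi-graphs of anabelioids* (2006), Rmk 3.1.2 pp. 33–34 (pull-back functors `B^temp(φ)`)
[cite: MochizukiSemiAnbd2006, Rmk 3.1.2 pp.33-34].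

abc-iut cell; cross-layer piece BY SIGNATURE (L1 `Frobenioids/QuasiTemperoid*` territory) for the layer-L2 row
«T44-L15b at the faithful [FrdII] Def 2.2 (ii) reading» (seat abc-iut-w6-d047 gen 2; HOME/staging/w6/w6-d047/g2/
T44-L15b-EPART-SPEC.md §2 `isoE`): the E-part of the Ψ-induced `Def22Context.Iso` needs `Aut_{E₁}((A)_{E₁}) ⥲
Aut_{E₂}((ΨA)_{E₂})` where `E_i = B^temp(G_{K_i})⁰` and `A_E = (aug_i)_*(A^bs)` — i.e. the compatibility of
abc-iut-L1-t4/L6-t8's CONSTRUCTED push-forward `QuasiTemperoid.orbits` / `pushforward` (`QuasiTemperoidPushforward.lean`)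
with transport along the square `(θ : Π^tp_{X₁} ⥲ Π^tp_{X₂}, ι : G_{K₁} ⥲ G_{K₂})`.  PROOF-ONLY (0 definitions, no instance,
no named fact): the natural isomorphisms are ∃-packaged with their pointwise formula `[x] ↦ [x]`.

* `res_obj_ρ_apply` — `(f^* X).ρ h x = X.ρ (f h) x` (rfl);
* `kerRel_res_symm_iff` — the `Ker(φ′)`-orbit relation on `(θ⁻¹)^* X` IS the `Ker(φ)`-orbit relation on `X`;
* **`exists_orbitsSquareIso`** — `∃ J : orbits φ ⋙ (ι⁻¹)^* ≅ (θ⁻¹)^* ⋙ orbits φ′` on all of `B^temp(Π)`, with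
  `(J_X) [x] = [x]`;
* **`exists_pushforwardSquareIso`** — the same on the connected parts: `∃ J : pushforward φ ⋙ pullback ι⁻¹ ≅
  pullback θ⁻¹ ⋙ pushforward φ′` with `(J_A) [x] = [x]`.
Elementary; nothing here bears on [IUTchIII] Cor. 3.12; typed ≠ proved elsewhere.
-/

noncomputable section

open CategoryTheory Topology
open Literature.AnabelianGeometry.SemiGraphs

namespace Literature.AlgebraicGeometry.Frobenioids

namespace QuasiTemperoid

universe u

section Square

variable {G₁ : Type u} [Group G₁] [TopologicalSpace G₁] [IsTopologicalGroup G₁]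
  {G₂ : Type u} [Group G₂] [TopologicalSpace G₂]
  {G₁' : Type u} [Group G₁'] [TopologicalSpace G₁'] [IsTopologicalGroup G₁']
  {G₂' : Type u} [Group G₂'] [TopologicalSpace G₂']
  (φ : G₁ →* G₂) (hs : Function.Surjective φ) (hφ : IsOpenMap φ)
  (φ' : G₁' →* G₂') (hs' : Function.Surjective φ') (hφ' : IsOpenMap φ')
  (θ : G₁ ≃ₜ* G₁') (ι : G₂ ≃ₜ* G₂') (hsq : ∀ g : G₁, ι (φ g) = φ' (θ g))

omit [IsTopologicalGroup G₁] in
/-- The action of a pulled-back `Π`-set: `(f^* X).ρ h x = X.ρ (f h) x`. [cite: MochizukiSemiAnbd2006, Rmk 3.1.2 pp.33-34] -/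
theorem res_obj_ρ_apply {H : Type u} [Group H] [TopologicalSpace H] (f : H →ₜ* G₁) (X : BTemp G₁) (h : H)
    (x : X.obj.V) : ((BTemp.res f).obj X).obj.ρ h x = X.obj.ρ (f h) x := rfl

include hsq in
omit [IsTopologicalGroup G₁] [IsTopologicalGroup G₁'] in
/-- `φ k = 1 ↔ φ′ (θ k) = 1` (the square and injectivity of `ι`). [cite: MochizukiFrdII2008, Thm 2.4 (i) p.19] -/
theorem map_eq_one_iff_of_square (k : G₁) : φ k = 1 ↔ φ' (θ k) = 1 := by
  rw [← hsq]
  exact (map_eq_one_iff ι ι.injective).symm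

include hsq in
omit [IsTopologicalGroup G₁] [IsTopologicalGroup G₁'] in
/-- **The `Ker(φ′)`-orbit relation on `(θ⁻¹)^* X` is the `Ker(φ)`-orbit relation on `X`.**
[cite: MochizukiFrdII2008, Ex 1.3 (ii) p.11] -/
theorem kerRel_res_symm_iff (X : BTemp G₁) (x y : X.obj.V) :
    (kerRel φ' ((BTemp.res (θ.symm : G₁' →ₜ* G₁)).obj X)) x y ↔ (kerRel φ X) x y := by
  constructor
  · rintro ⟨k', hk', h⟩
    refine ⟨θ.symm k', ?_, h⟩
    rw [map_eq_one_iff_of_square φ φ' θ ι hsq, ContinuousMulEquiv.apply_symm_apply]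
    exact hk'
  · rintro ⟨k, hk, h⟩
    refine ⟨θ k, (map_eq_one_iff_of_square φ φ' θ ι hsq k).1 hk, ?_⟩
    change X.obj.ρ ((θ.symm : G₁' →ₜ* G₁) (θ k)) x = y
    rw [show ((θ.symm : G₁' →ₜ* G₁) (θ k) : G₁) = k from θ.symm_apply_apply k]
    exact h

include hsq in
/-- **[FrdII] Ex 1.3 (ii): `φ_*` is functorial in the square** — on all of `B^temp(Π)`: a natural isomorphism
`orbits φ ⋙ (ι⁻¹)^* ≅ (θ⁻¹)^* ⋙ orbits φ′` which is the IDENTITY on representatives, `[x] ↦ [x]`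
(`E/Ker(φ)` and `E/Ker(φ′)` are the same quotient of the same set, and `g′ ∈ G′` acts on both through any `g ∈ Π`
with `φ′(θ g) = g′`). [cite: MochizukiFrdII2008, Ex 1.3 (ii) p.11] -/
theorem exists_orbitsSquareIso :
    ∃ J : orbits φ hs hφ ⋙ BTemp.res (ι.symm : G₂' →ₜ* G₂) ≅
        BTemp.res (θ.symm : G₁' →ₜ* G₁) ⋙ orbits φ' hs' hφ',
      ∀ (X : BTemp G₁) (x : X.obj.V),
        ((J.hom.app X).hom.hom (orbitMk x : OrbitSet φ X) :
          OrbitSet φ' ((BTemp.res (θ.symm : G₁' →ₜ* G₁)).obj X)) =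
          orbitMk (X := (BTemp.res (θ.symm : G₁' →ₜ* G₁)).obj X) x := by
  -- the identity on representatives, in both directions
  let e : ∀ X : BTemp G₁, OrbitSet φ X ≃ OrbitSet φ' ((BTemp.res (θ.symm : G₁' →ₜ* G₁)).obj X) := fun X =>
    Quotient.congr (Equiv.refl _) fun x y => (kerRel_res_symm_iff φ φ' θ ι hsq X x y).symm
  have e_mk : ∀ (X : BTemp G₁) (x : X.obj.V),
      e X (orbitMk x) = orbitMk (X := (BTemp.res (θ.symm : G₁' →ₜ* G₁)).obj X) x := fun X x => rfl
  -- equivariance: `g′ · [x]` computed on either side is `[g · x]` for any `g` with `φ′ (θ g) = g′`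
  have hequiv : ∀ (X : BTemp G₁) (g' : G₂') (q : OrbitSet φ X),
      e X (((orbits φ hs hφ ⋙ BTemp.res (ι.symm : G₂' →ₜ* G₂)).obj X).obj.ρ g' q) =
        ((BTemp.res (θ.symm : G₁' →ₜ* G₁) ⋙ orbits φ' hs' hφ').obj X).obj.ρ g' (e X q) := by
    intro X g' q
    induction q using Quotient.ind with
    | _ x =>
      -- a common representative `s` of `g′` through `Π`
      set s : G₁ := Function.surjInv hs (ι.symm g') with hs_def
      have hφs : φ s = ι.symm g' := Function.surjInv_eq hs _
      have hφ's : φ' (θ s) = g' := by rw [← hsq, hφs, ContinuousMulEquiv.apply_symm_apply]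
      change e X ((orbitObj φ hs hφ X).obj.ρ ((ι.symm : G₂' →ₜ* G₂) g') (orbitMk x)) =
        (orbitObj φ' hs' hφ' ((BTemp.res (θ.symm : G₁' →ₜ* G₁)).obj X)).obj.ρ g' (orbitMk x)
      rw [show ((ι.symm : G₂' →ₜ* G₂) g' : G₂) = φ s from hφs.symm, orbitObj_ρ_mk, e_mk, ← hφ's, orbitObj_ρ_mk,
        res_obj_ρ_apply]
      rw [show ((θ.symm : G₁' →ₜ* G₁) (θ s) : G₁) = s from θ.symm_apply_apply s]
  -- the components, as isomorphisms of `B^temp(G′)`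
  let j : ∀ X : BTemp G₁, (orbits φ hs hφ ⋙ BTemp.res (ι.symm : G₂' →ₜ* G₂)).obj X ≅
      (BTemp.res (θ.symm : G₁' →ₜ* G₁) ⋙ orbits φ' hs' hφ').obj X := fun X =>
    ObjectProperty.isoMk _ (Action.mkIso (e X).toIso fun g' => by
      apply ConcreteCategory.hom_ext
      intro q
      exact hequiv X g' q)
  refine ⟨NatIso.ofComponents j fun {X Y} f => ?_, fun X x => rfl⟩
  apply BTempConnected.hom_ext_apply
  intro q
  induction q using Quotient.ind with
  | _ x => rfl

include hsq in
/-- **[FrdII] Ex 1.3 (ii), on the connected parts: `pushforward φ ⋙ pullback ι⁻¹ ≅ pullback θ⁻¹ ⋙ pushforward φ′`**,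
the identity on representatives (`(J_A) [x] = [x]`) — the push-forward `B^temp(Π)⁰ → B^temp(G)⁰` transported along a
commuting square of topological isomorphisms `θ : Π ⥲ Π′`, `ι : G ⥲ G′` (`ι ∘ φ = φ′ ∘ θ`; Thm 2.4 (i): "an outer
isomorphism `Π₁ ⥲ Π₂` … that lies over an outer isomorphism `G₁ ⥲ G₂`"). [cite: MochizukiFrdII2008, Ex 1.3 (ii) p.11] -/
theorem exists_pushforwardSquareIso :
    ∃ J : pushforward φ hs hφ ⋙ pullback (ι.symm : G₂' →ₜ* G₂).toMonoidHom ι.symm.surjective (ι.symm.continuous) ≅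
        pullback (θ.symm : G₁' →ₜ* G₁).toMonoidHom θ.symm.surjective (θ.symm.continuous) ⋙ pushforward φ' hs' hφ',
      ∀ (A : ConnectedPart (BTemp G₁)) (x : A.obj.obj.V),
        ((J.hom.app A).hom.hom.hom (orbitMk x : OrbitSet φ A.obj) :
          OrbitSet φ' ((BTemp.res (θ.symm : G₁' →ₜ* G₁)).obj A.obj)) =
          orbitMk (X := (BTemp.res (θ.symm : G₁' →ₜ* G₁)).obj A.obj) x := by
  obtain ⟨J, hJ⟩ := exists_orbitsSquareIso φ hs hφ φ' hs' hφ' θ ι hsq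
  refine ⟨NatIso.ofComponents (fun A => (connectedObjects (BTemp G₂')).isoMk (J.app A.obj)) fun {A B} f => ?_,
    fun A x => hJ A.obj x⟩
  exact (connectedObjects (BTemp G₂')).hom_ext (J.hom.naturality f.hom)

end Square

end QuasiTemperoid

end Literature.AlgebraicGeometry.Frobenioids

end
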